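import Mathlib
import HarnessLib
import Literature.MathematicalPhysics.StatisticalMechanics.LinearisedMapLargePartNorm
import Literature.MathematicalPhysics.StatisticalMechanics.LinearisedMapBlockTerm
import Literature.MathematicalPhysics.StatisticalMechanics.WeightTheoremABKM
import Literature.MathematicalPhysics.StatisticalMechanics.WeightIntegrationStepABKM
import Literature.MathematicalPhysics.StatisticalMechanics.WeightFieldNormABKM
import Literature.MathematicalPhysics.StatisticalMechanics.WeightParametersABKM
import Literature.MathematicalPhysics.StatisticalMechanics.PolymerClosureGain

/-!
# The norm parameters of [ABKM19] on the torus and the discharge of the analytic hypotheses of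
# Lemma 10.1/10.2: (w7) `IntegrationProperty`, (w6) `NextWeightDominates`, (w9) `W9At`

`LinearisedMapLargePartNorm` / `LinearisedMapBlockTerm` / `LinearisedMapNorm` state Lemmas 10.1–10.4
of [ABKM19] for ABSTRACT norm parameters `P : NormParams d M` under three named hypothesis shapes.
Here we fix the concrete parameters of the source,

* `abkmNormParams L N Mord R p r₀ h θ̄ A δ' 𝒞` — gauge weights `𝔥_k = 2^k h L^{−k(d−2)/2}`
  (`fieldWt`, (6.40)), `R_k = L^k`, gauge order `p = p_Φ`, Taylor order `r₀`, small-set radii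
  `starRad` ((6.25)), base `L`, large-set parameter `A`, weight tower `abkmWeightData` ((7.2)–(7.5)),

and DISCHARGE the three shapes from Theorem 7.1 for the torus (`WeightTheoremABKM.AbkmWeightBounds`):

* **`integrationProperty_abkm`** — (w7)/Lemma 8.4 (`ℓ = 0`): `IntegrationProperty P k (𝒞_{k+1}) A_𝒫`
  for `k + 1 ≤ N + 1`, with the SAME constant `A_𝒫` as `AbkmWeightBounds.integral` (via the
  section-domination form of Lemma 8.4, `TayNormLE.integral_comp_add_section`);
* **`nextWeightDominates_abkm`** — (w6): `w_{k:k+1}^X ≤ w_{k+1}^{π(X)}` for connected `k`-polymers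
  (`X ⊆ X* ⊆ π(X)*` by (6.28), then Lemma 7.5 (iv) and `A_{k:k+1}^{U*} ⪯ A_{k+1}^U`);
* **`w9At_abkm`** — (w9): `e^{‖T_{k+1}^{U*}φ‖²/2} w_{k:k+1}^U(φ) ≤ w_{k+1}^U(φ)` for `(k+1)`-polymers
  `U`, `k + 1 ≤ N`, `h² ≥ h₀²` (`WeightFieldNormABKM.exp_fieldGauge_sq_mul_midWeight_le`);
* `closureGain_of_brydges` — the closure-gain hypothesis shape of Lemma 10.2 from the named fact
  `TorusPolymer.BrydgesClosureGain d` ([Bry09] Lemma 6.15).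

Everything here is proved (the last item is an implication from the named fact); no new fact.

## References
* S. Adams, S. Buchholz, R. Kotecký, S. Müller, arXiv:1910.13564, Ch. 6.4 (6.40)–(6.50), Theorem 7.1
  (w6), (w7), (w9), Lemma 8.4, Lemmas 10.1–10.2 [AdamsBuchholzKoteckyMuller2019].
* D. C. Brydges, IAS/Park City Math. Ser. 16 (2009), Lemma 6.15 [Brydges2009].
-/

noncomputable section

namespace Literature.MathematicalPhysics.StatisticalMechanics.GradientRG

open scoped BigOperators Classical MatrixOrder
open Finset Matrix MeasureTheory ProbabilityTheory WithLp
open Literature.MathematicalPhysics.StatisticalMechanics.GradientFRD (cExt fourierCoeff mulMat)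
open Literature.MathematicalPhysics.StatisticalMechanics.TorusPolymer
  (IsPolymer blocks numBlocks closure reblock thicken subset_thicken thicken_subset_thicken_reblock)
open Literature.Barriers.CriticalPhenomena.LongRangePhi4.Polymer (IsConn)
open Literature.MathematicalPhysics.QuantumFieldTheory

variable {d M : ℕ} [NeZero M]

/-! ## The concrete norm parameters -/

/-- **The norm parameters of [ABKM19] on `(ℤ/M)^d`, `M = L^N`**: `𝔥_k = h_k L^{−k(d−2)/2}` with
`h_k = 2^k h` (`fieldWt`), `R_k = L^k`, gauge order `p` (`p_Φ`), Taylor order `r₀`, small-set radius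
`starRad R L d k` (`X*`, (6.25)), base `L`, large-set parameter `A` of (6.50), and the weight tower
`abkmWeightData L N Mord R θ̄ δ' 𝒞` of (7.2)–(7.5).
[cite: AdamsBuchholzKoteckyMuller2019, Ch. 6.4 (6.40)–(6.50)] -/
def abkmNormParams (L N Mord R p r₀ : ℕ) (h θbar A : ℝ) (δ' : ℕ → ℝ)
    (𝒞 : ℕ → (Fin d → ZMod M) → ℝ) : NormParams d M where
  𝔥 k := fieldWt h (L : ℝ) d k
  R k := (L : ℝ) ^ k
  p := p
  r₀ := r₀
  rad := starRad R L d
  L := L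
  A := A
  W := abkmWeightData L N Mord R θbar δ' 𝒞

section Unfold

variable (L N Mord R p r₀ : ℕ) (h θbar A : ℝ) (δ' : ℕ → ℝ) (𝒞 : ℕ → (Fin d → ZMod M) → ℝ)

/-- `𝔥_k = fieldWt h L d k`. [cite: AdamsBuchholzKoteckyMuller2019, Ch. 6.4 (6.40)] -/
@[simp] theorem abkmNormParams_𝔥 (k : ℕ) :
    (abkmNormParams L N Mord R p r₀ h θbar A δ' 𝒞).𝔥 k = fieldWt h (L : ℝ) d k := rfl

/-- `R_k = L^k`. [cite: AdamsBuchholzKoteckyMuller2019, Ch. 6.4 (6.40)] -/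
@[simp] theorem abkmNormParams_R (k : ℕ) :
    (abkmNormParams L N Mord R p r₀ h θbar A δ' 𝒞).R k = (L : ℝ) ^ k := rfl

/-- `p = p_Φ`. [cite: AdamsBuchholzKoteckyMuller2019, Ch. 6.4 (6.40)] -/
@[simp] theorem abkmNormParams_p : (abkmNormParams L N Mord R p r₀ h θbar A δ' 𝒞).p = p := rfl

/-- `r₀`. [cite: AdamsBuchholzKoteckyMuller2019, Ch. 6.4 (6.46)] -/
@[simp] theorem abkmNormParams_r₀ : (abkmNormParams L N Mord R p r₀ h θbar A δ' 𝒞).r₀ = r₀ := rfl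

/-- `rad = starRad`. [cite: AdamsBuchholzKoteckyMuller2019, Ch. 6.2 (6.25)] -/
@[simp] theorem abkmNormParams_rad :
    (abkmNormParams L N Mord R p r₀ h θbar A δ' 𝒞).rad = starRad R L d := rfl

/-- the base `L`. [cite: AdamsBuchholzKoteckyMuller2019, Ch. 6.2] -/
@[simp] theorem abkmNormParams_L : (abkmNormParams L N Mord R p r₀ h θbar A δ' 𝒞).L = L := rfl

/-- the large-set parameter `A`. [cite: AdamsBuchholzKoteckyMuller2019, Ch. 6.4 (6.50)] -/
@[simp] theorem abkmNormParams_A : (abkmNormParams L N Mord R p r₀ h θbar A δ' 𝒞).A = A := rfl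

/-- the weight tower. [cite: AdamsBuchholzKoteckyMuller2019, Ch. 7.1 (7.5)] -/
@[simp] theorem abkmNormParams_W :
    (abkmNormParams L N Mord R p r₀ h θbar A δ' 𝒞).W = abkmWeightData L N Mord R θbar δ' 𝒞 := rfl

/-- The gauge `T_k^{X*}` of the concrete parameters.
[cite: AdamsBuchholzKoteckyMuller2019, Ch. 6.4 (6.47)] -/
theorem abkmNormParams_gauge (k : ℕ) (X : Finset (Fin d → ZMod M)) :
    (abkmNormParams L N Mord R p r₀ h θbar A δ' 𝒞).gauge k X =
      fieldGauge (fieldWt h (L : ℝ) d k) ((L : ℝ) ^ k) p (thicken (starRad R L d k) X) := rfl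

end Unfold

/-! ## The radii of `X*` at consecutive scales -/

/-- `starRad` at scale `0` is `R`. [cite: AdamsBuchholzKoteckyMuller2019, Ch. 6.2 (6.25)] -/
theorem starRad_zero (R L d : ℕ) : starRad R L d 0 = R := rfl

/-- `starRad` at scale `1` is `2^d + R`. [cite: AdamsBuchholzKoteckyMuller2019, Ch. 6.2 (6.25)] -/
theorem starRad_one (R L d : ℕ) : starRad R L d 1 = 2 ^ d + R := rfl

/-- `starRad` at scale `k + 2` is `2^d L^{k+1}`. [cite: AdamsBuchholzKoteckyMuller2019, Ch. 6.2 (6.25)] -/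
theorem starRad_add_two (R L d k : ℕ) : starRad R L d (k + 2) = 2 ^ d * L ^ (k + 1) := rfl

/-- The radii of `X*` increase with the scale (`L ≥ 2^d + R`).
[cite: AdamsBuchholzKoteckyMuller2019, Ch. 6.2 (6.25)] -/
theorem starRad_le_succ {R L d : ℕ} (hL : 2 ^ d + R ≤ L) (k : ℕ) :
    starRad R L d k ≤ starRad R L d (k + 1) := by
  have h2d : 1 ≤ 2 ^ d := Nat.one_le_two_pow
  have hL1 : 1 ≤ L := le_trans (by omega) hL
  rcases k with _ | _ | k
  · rw [starRad_zero, starRad_one]; omega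
  · rw [starRad_one, starRad_add_two, pow_one]
    calc 2 ^ d + R ≤ L := hL
      _ = 1 * L := (one_mul L).symm
      _ ≤ 2 ^ d * L := Nat.mul_le_mul_right L h2d
  · rw [starRad_add_two, show k + 1 + 2 = (k + 1) + 2 from rfl, starRad_add_two]
    exact Nat.mul_le_mul_left _ (Nat.pow_le_pow_right hL1 (by omega))

/-- **The radii condition of (6.28)**: `r_k + (2^d − 1)L^k ≤ r_{k+1}` for `L ≥ 2^d + R`
(so that `X* ⊆ π(X)*`). [cite: AdamsBuchholzKoteckyMuller2019, Ch. 6.2 (6.28)] -/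
theorem starRad_add_le_succ {R L d : ℕ} (hL : 2 ^ d + R ≤ L) (k : ℕ) :
    starRad R L d k + (2 ^ d - 1) * L ^ k ≤ starRad R L d (k + 1) := by
  have h2d : 1 ≤ 2 ^ d := Nat.one_le_two_pow
  have hL1 : 1 ≤ L := le_trans (by omega) hL
  rcases k with _ | _ | k
  · rw [starRad_zero, starRad_one, pow_zero, mul_one]; omega
  · rw [starRad_one, starRad_add_two, pow_one]
    have h1 : (2 ^ d - 1) * L + L = 2 ^ d * L := by
      rw [Nat.sub_mul, Nat.one_mul, Nat.sub_add_cancel (Nat.le_mul_of_pos_left L (by omega))]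
    omega
  · rw [starRad_add_two, show k + 1 + 2 = (k + 1) + 2 from rfl, starRad_add_two]
    have h1 : (2 ^ d - 1) * L ^ (k + 1 + 1) + L ^ (k + 1 + 1) = 2 ^ d * L ^ (k + 1 + 1) := by
      rw [Nat.sub_mul, Nat.one_mul, Nat.sub_add_cancel (Nat.le_mul_of_pos_left _ (by omega))]
    have h2 : 2 ^ d * L ^ (k + 1) ≤ L ^ (k + 1 + 1) := by
      rw [pow_succ L (k + 1), mul_comm (L ^ (k + 1))]
      exact Nat.mul_le_mul_right _ (by omega)
    omega

/-! ## (w7): the integration property with the constant of Theorem 7.1 -/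

/-- **(w7) / Lemma 8.4 (`ℓ = 0`) for the concrete parameters.**  If the weight tower satisfies the
conclusions of Theorem 7.1 (`AbkmWeightBounds`, integration constant `A_𝒫`), then for every scale
`k` with `k + 1 ≤ N + 1` the integration property holds for the step kernel `𝒞_{k+1}` with `κ = A_𝒫`:
`‖R_{k+1}F‖_{k:k+1,X} ≤ A_𝒫^{|X|_k} ‖F‖_{k,X}` for every connected `k`-polymer `X` and every
`T_k^{X*}`-local `C^{r₀}` functional `F` (`θ̄ > 0`, `λ > 0`; any gauge order `p`, Taylor order
`r₀`, `h`, `A`).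
[cite: AdamsBuchholzKoteckyMuller2019, Lemma 8.4 (8.5)] -/
theorem integrationProperty_abkm {L N Mord R n : ℕ} {θbar lam μ δ₁ δ₀ A𝒫 : ℝ}
    {𝒞 : ℕ → (Fin d → ZMod M) → ℝ} (hθbar : 0 < θbar) (hlam : 0 < lam)
    (hB : AbkmWeightBounds L N Mord R n θbar lam μ δ₁ δ₀ A𝒫 𝒞
      (abkmWeightData L N Mord R θbar (schedDelta δ₀ δ₁ N) 𝒞))
    {k : ℕ} (hk : k + 1 ≤ N + 1) (p r₀ : ℕ) (h A : ℝ) :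
    IntegrationProperty (abkmNormParams L N Mord R p r₀ h θbar A (schedDelta δ₀ δ₁ N) 𝒞) k
      (𝒞 (k + 1)) A𝒫 := by
  intro X hX _ F C hC hFd hFloc hF
  set P := abkmNormParams L N Mord R p r₀ h θbar A (schedDelta δ₀ δ₁ N) 𝒞 with hP
  set W := abkmWeightData L N Mord R θbar (schedDelta δ₀ δ₁ N) 𝒞 with hW
  show TayNormLE (P.gauge k X) r₀ (W.midWeight k X)
    (fun ψ => ∫ ξ, F (ψ + ξ) ∂(stepMeasure (𝒞 (k + 1)))) (C * A𝒫 ^ numBlocks (L ^ k) X)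
  -- kernel facts from Theorem 7.1
  have heven_all : ∀ j ∈ Icc 1 (N + 1), ∀ x, 𝒞 j (-x) = 𝒞 j x := fun j hj => (hB.zero_sum_even j hj).2
  have heven : ∀ x, 𝒞 (k + 1) (-x) = 𝒞 (k + 1) x :=
    heven_all (k + 1) (mem_Icc.2 ⟨by omega, hk⟩)
  have hf_even := fun κ j => GradientFRD.cExt_fourierCoeff_neg (N := N) heven_all κ j
  have hnn := hB.multipliers_nonneg
  have hD := hB.dominated
  have hθlo : θbar ≤ thetaSeq θbar μ δ₁ N k := (hB.theta_mem k).1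
  -- subcriticality of `(1 + θ̄/2) A_k^X` for the step covariance
  have hCeq := circulant_eq_mulMat_cExt hk heven (N := N)
  have hsub : ((1 : Matrix _ _ ℝ) - CFC.sqrt (Matrix.circulant (𝒞 (k + 1))) *
      ((1 + θbar / 2) • W.form k X) * CFC.sqrt (Matrix.circulant (𝒞 (k + 1)))).PosDef := by
    rw [hCeq]
    exact posDef_one_sub_smul_form W (c := fun j κ => cExt N (fun j => fourierCoeff (𝒞 j) κ) j)
      hD hθbar hθlo hlam.le (by linarith) (by linarith)
      (fun k κ => derivMul_neg _ k _ κ) (fun κ => derivMul_nonneg (Nat.cast_nonneg L) k _ κ)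
      (fun κ => hf_even κ (k + 1)) (fun κ => hnn (k + 1) κ)
      (fun k κ => tailMul_neg_of_cExt hf_even k κ) (fun κ => tailMul_succ N _ k κ)
      (fun κ => tailMul_nonneg (fun κ j => hnn j κ) (k + 1) κ) X
  have hwe : W.weight k X = expWeight (W.form k X) :=
    funext fun φ => WeightData.weight_eq_expWeight k X φ
  have hdom : WeightSectionDominated (P.gauge k X) (W.weight k X) (stepMeasure (𝒞 (k + 1))) := by
    rw [hwe]
    exact weightSectionDominated_expWeight (P.gauge k X) (C := Matrix.circulant (𝒞 (k + 1)))
      (WeightData.form_posSemidef hD k X) (η := θbar / 2) (by linarith) hsub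
  -- (w7) on field space, with the constant of Theorem 7.1
  have hw7 : ∀ φ, ∫ ξ, W.weight k X (φ + ξ) ∂(stepMeasure (𝒞 (k + 1))) ≤
      A𝒫 ^ numBlocks (L ^ k) X * W.midWeight k X φ := fun φ => by
    rw [integral_stepMeasure (continuous_weight_comp_add _ k X φ)]
    exact hB.integral k hk X hX φ
  exact hF.integral_comp_add_section hC hFd hFloc hdom
    (integrable_weight_abkm hθbar.le hD hnn hk heven X) hw7

/-! ## (w6): `w_{k:k+1}^X ≤ w_{k+1}^{π(X)}` -/

/-- **(w6) for the concrete parameters**: for a dominated, monotone tower (`AbkmWeightBounds`) and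
`L` odd with `2^d + R ≤ L` (so that `X* ⊆ π(X)*`, (6.28)), on the torus `M = L^{k+1}·t` (`t` odd):
`w_{k:k+1}^X(φ) ≤ w_{k+1}^{π(X)}(φ)` for every connected `k`-polymer `X`.
[cite: AdamsBuchholzKoteckyMuller2019, Theorem 7.1 (w6)] -/
theorem nextWeightDominates_abkm {L N Mord R n : ℕ} {θbar lam μ δ₁ δ₀ A𝒫 : ℝ}
    {𝒞 : ℕ → (Fin d → ZMod M) → ℝ}
    (hB : AbkmWeightBounds L N Mord R n θbar lam μ δ₁ δ₀ A𝒫 𝒞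
      (abkmWeightData L N Mord R θbar (schedDelta δ₀ δ₁ N) 𝒞))
    (hLodd : Odd L) (hL : 2 ^ d + R ≤ L) {k t : ℕ} (hM : M = L ^ (k + 1) * t) (ht : Odd t)
    (p r₀ : ℕ) (h A : ℝ) :
    NextWeightDominates (abkmNormParams L N Mord R p r₀ h θbar A (schedDelta δ₀ δ₁ N) 𝒞) k := by
  intro X _ _ φ
  set W := abkmWeightData L N Mord R θbar (schedDelta δ₀ δ₁ N) 𝒞 with hW
  have hMk : M = L ^ k * (L * t) := hM.trans (by rw [pow_succ]; ring)
  have hrad : starRad R L d k ≤ starRad R L d (k + 1) := starRad_le_succ hL k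
  have hrad' : starRad R L d k + (2 ^ d - 1) * L ^ k ≤ starRad R L d (k + 1) :=
    starRad_add_le_succ hL k
  have hsub : X ⊆ thicken (starRad R L d (k + 1)) (reblock (L ^ k) (L * L ^ k) X) :=
    (subset_thicken _ X).trans (thicken_subset_thicken_reblock hMk hLodd.pow (hLodd.mul ht) hLodd
      hrad hrad' X)
  exact (WeightData.midWeight_mono hB.dominated hB.monotone k hsub φ).trans
    (WeightData.midWeight_enl_le_weight_succ hB.dominated k _ φ)

/-! ## (w9) at the `(k+1)`-polymers -/

/-- **(w9) for the concrete parameters**: for `d ≥ 2`, `L` odd, `L ≥ 2^{d+3} + 16R`, `M = L^N`,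
`k + 1 ≤ N`, `p + d ≤ M_ord`, `h > 0` with `h² ≥ h₀²(d, R, δ₀, δ₁)` (`hZeroSq`), and a dominated
monotone tower: `e^{‖T_{k+1}^{U*}φ‖²/2} w_{k:k+1}^U(φ) ≤ w_{k+1}^U(φ)` for every `(k+1)`-polymer `U`.
[cite: AdamsBuchholzKoteckyMuller2019, Theorem 7.1 (w9)] -/
theorem w9At_abkm {L N Mord R n p : ℕ} {θbar lam μ δ₁ δ₀ A𝒫 h : ℝ}
    {𝒞 : ℕ → (Fin d → ZMod M) → ℝ} (hd : 2 ≤ d) (hLodd : Odd L) (hL : 2 ^ (d + 3) + 16 * R ≤ L)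
    (hM : M = L ^ N) {k : ℕ} (hk : k + 1 ≤ N) (hpM : p + d ≤ Mord)
    (hB : AbkmWeightBounds L N Mord R n θbar lam μ δ₁ δ₀ A𝒫 𝒞
      (abkmWeightData L N Mord R θbar (schedDelta δ₀ δ₁ N) 𝒞))
    (hδ₀ : 0 < δ₀) (hδ₁ : 0 < δ₁) (hh : 0 < h) (hh0 : hZeroSq d R δ₀ δ₁ ≤ h ^ 2) (r₀ : ℕ) (A : ℝ)
    {U : Finset (Fin d → ZMod M)} (hU : IsPolymer (L ^ (k + 1)) U) :
    W9At (abkmNormParams L N Mord R p r₀ h θbar A (schedDelta δ₀ δ₁ N) 𝒞) k U := by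
  intro φ
  have hL0 : (0 : ℝ) < L := by exact_mod_cast hLodd.pos
  have hcond := field_norm_cond (d := d) (R := R) hδ₀ hδ₁ hL0 hh0 hk
  exact exp_fieldGauge_sq_mul_midWeight_le hd hLodd hL hM hk hpM hB.dominated hB.monotone
    (fieldWt_pos hh hL0 d (k + 1)) hcond hU φ

/-! ## The closure gain from Brydges' Lemma 6.15 -/

/-- The closure-gain hypothesis of Lemma 10.2 (`η |X̄|_{k+1} ≤ |X|_k` for large connected `X`) for the
concrete parameters, from the named fact `TorusPolymer.BrydgesClosureGain d` ([Bry09] Lemma 6.15), on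
the torus `M = L^{k+1}·t` with `L, t` odd and `L ≥ 2^d + 1`.
[cite: Brydges2009, Lemma 6.15] -/
theorem closureGain_of_brydges (hBCG : TorusPolymer.BrydgesClosureGain d) :
    ∃ η : ℝ, 1 < η ∧ ∀ (L t : ℕ) (M : ℕ) [NeZero M], Odd L → Odd t → 2 ^ d + 1 ≤ L →
      ∀ k : ℕ, M = L ^ (k + 1) * t →
        ∀ X : Finset (Fin d → ZMod M), IsPolymer (L ^ k) X → IsConn X →
          2 ^ d < (blocks (L ^ k) X).card →
            η * ((blocks (L * L ^ k) (closure (L * L ^ k) X)).card : ℝ) ≤ (blocks (L ^ k) X).card := by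
  obtain ⟨η, hη, hall⟩ := hBCG
  refine ⟨η, hη, fun L t M _ hL ht hL2 k hM X hX hc hlarge => ?_⟩
  exact hall L (L ^ k) t M hL hL.pow ht hL2 (by rw [hM, pow_succ]; ring) X hX hc hlarge

end Literature.MathematicalPhysics.StatisticalMechanics.GradientRG

end
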